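import Summits.RiemannHypothesis.RiemannHypothesis.Theorems.PfPersistenceParityMassLaw
import HarnessLib

/-!
# PF persistence — the PARITY-MASS LAW, ODD sector (pub-rhpf, cand-6 gen 6; companion of `PfPersistenceParityMassLaw`)

**HONEST FRAMING. This is a long-odds MECHANISM SEARCH ('mechanism/rigidity campaign'); no RH claims.** RH-free,
weight-free trigonometry about the cell's odd-sector SHAPE readers (`OneSignedOdd` / `FloorOneSignedOdd` on the odd
profile `θ⁻_u = Σ_j u_j ξ₋₍ⱼ₊₁₎` over the half-window `H = [0, L/2]`, barrier-typer 3921317826c4); nothing here bears on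
the truth of RH. Labels: PROVED = kernel-checked here or in the imported tree files.

* THE REFLECTION OF `H` (PROVED): `ξ₋ₙ(L/2 − x) = −(−1)^n ξ₋ₙ(x)`, so `x ↦ L/2 − x` FIXES the odd-n sine modes and
  NEGATES the even-n ones: `θ⁻_u(L/2 − x) = θ⁻_{flipOdd u}(x)` with `(flipOdd u)_j = (−1)^j u_j`, and
  `θ⁻_u + θ⁻_{flipOdd u} = 2 θ⁻_{u^{om}}` (`u^{om}` = the odd-MODE part: coordinates `j` even, modes `n = j+1` odd).
* SINE ORTHONORMALITY / PARSEVAL on the window (PROVED `integral_xiOdd_mul_xiOdd`, `integral_profileOdd_sq`).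
* **PARITY-MASS LAW, odd sector (PROVED `parityMassOdd_le_of_floorOneSignedOdd`):** `FloorOneSignedOdd L φ u`
  (`0 < L`, `0 ≤ φ`) gives `‖u‖² ≤ 8 ‖u^{om}‖² + 4 φ² N ‖u‖²`; raw: `‖u‖² ≤ 8 ‖u^{om}‖²`; `8 φ² N ≤ 1`: `‖u‖² ≤ 16 ‖u^{om}‖²`;
  a nonzero vector supported on even-n sine modes is never one-signed on `H` (antisymmetric about `L/4`).
-/

set_option linter.dupNamespace false  -- the mandated namespace repeats `RiemannHypothesis`

noncomputable section

open Real Set Matrix Finset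

namespace Summit.RiemannHypothesis.RiemannHypothesis.Theorems.PfPersistence

/-! ## §3 Odd sector: the reflection `x ↦ L/2 − x` of the half-window and the sine Parseval -/

/-- The PARITY FLIP of an odd-sector coefficient vector (coordinate `j` = mode `ξ₋₍ⱼ₊₁₎`): `(flipVecOdd u)_j = (−1)^j u_j`,
i.e. the odd-n sine modes are fixed and the even-n ones negated. [folklore] -/
def flipVecOdd {N : ℕ} (u : Fin N → ℝ) : Fin N → ℝ := fun j => (-1 : ℝ) ^ (j : ℕ) * u j

/-- The ODD-MODE PART of an odd-sector vector: coordinates `j` with `j` even (modes `n = j+1` odd) kept. [folklore] -/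
def oddModePart {N : ℕ} (u : Fin N → ℝ) : Fin N → ℝ := fun j => if Even (j : ℕ) then u j else 0

/-- PROVED: involution. [folklore] -/
theorem flipVecOdd_flipVecOdd {N : ℕ} (u : Fin N → ℝ) : flipVecOdd (flipVecOdd u) = u := by
  funext j
  simp only [flipVecOdd]
  rw [← mul_assoc, ← mul_pow]
  norm_num

/-- PROVED: `u + flipOdd u = 2 u^{om}` coordinatewise. [folklore] -/
theorem add_flipVecOdd_apply {N : ℕ} (u : Fin N → ℝ) (j : Fin N) :
    u j + flipVecOdd u j = 2 * oddModePart u j := by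
  unfold flipVecOdd oddModePart
  rcases Nat.even_or_odd (j : ℕ) with h | h
  · rw [if_pos h, h.neg_one_pow]; ring
  · rw [if_neg (Nat.not_even_iff_odd.2 h), h.neg_one_pow]; ring

/-- **PROVED — THE REFLECTION OF THE HALF-WINDOW:** `ξ₋ₙ(L/2 − x) = −(−1)^n ξ₋ₙ(x)` (`L ≠ 0`). [folklore] -/
theorem xiOdd_half_sub {L : ℝ} (hL : L ≠ 0) (n : ℕ) (x : ℝ) :
    xiOdd L n (L / 2 - x) = -((-1 : ℝ) ^ n * xiOdd L n x) := by
  unfold xiOdd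
  have harg : 2 * π * n * (L / 2 - x) / L = n * π - 2 * π * n * x / L := by
    field_simp
  rw [harg, Real.sin_nat_mul_pi_sub]
  ring

/-- PROVED: `θ⁻_u(L/2 − x) = θ⁻_{flipOdd u}(x)`. [folklore] -/
theorem profileOdd_half_sub {L : ℝ} (hL : L ≠ 0) {N : ℕ} (u : Fin N → ℝ) (x : ℝ) :
    profileOdd L u (L / 2 - x) = profileOdd L (flipVecOdd u) x := by
  unfold profileOdd flipVecOdd
  refine Finset.sum_congr rfl fun j _ => ?_
  rw [xiOdd_half_sub hL, pow_succ]
  ring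

/-- PROVED: `θ⁻_u + θ⁻_{flipOdd u} = 2 θ⁻_{u^{om}}`. [folklore] -/
theorem profileOdd_add_profileOdd_flipVecOdd {L : ℝ} {N : ℕ} (u : Fin N → ℝ) (x : ℝ) :
    profileOdd L u x + profileOdd L (flipVecOdd u) x = 2 * profileOdd L (oddModePart u) x := by
  unfold profileOdd
  rw [← Finset.sum_add_distrib, Finset.mul_sum]
  refine Finset.sum_congr rfl fun j _ => ?_
  rw [← add_mul, add_flipVecOdd_apply]
  ring

/-- PROVED: the odd modes are continuous. [folklore] -/
@[fun_prop]
theorem continuous_xiOdd (L : ℝ) (n : ℕ) : Continuous (xiOdd L n) := by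
  unfold xiOdd
  fun_prop

/-- PROVED: `ξ₋ₙ(x)² ≤ 2/L` (`0 < L`). [folklore] -/
theorem xiOdd_sq_le {L : ℝ} (hL : 0 < L) (n : ℕ) (x : ℝ) : xiOdd L n x ^ 2 ≤ 2 / L := by
  unfold xiOdd
  rw [mul_pow, mul_pow, ← pow_mul, show n * 2 = 2 * n by ring, pow_mul, neg_one_sq, one_pow, one_mul,
    Real.sq_sqrt (by positivity)]
  calc 2 / L * Real.sin (2 * π * n * x / L) ^ 2 ≤ 2 / L * 1 := by
        gcongr
        exact Real.sin_sq_le_one _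
    _ = 2 / L := mul_one _

/-- PROVED: `θ⁻_u(x)² ≤ ‖u‖² · N · 2/L` (Cauchy–Schwarz). [folklore] -/
theorem profileOdd_sq_le {L : ℝ} (hL : 0 < L) {N : ℕ} (u : Fin N → ℝ) (x : ℝ) :
    profileOdd L u x ^ 2 ≤ (u ⬝ᵥ u) * (N * (2 / L)) := by
  have hcs := Finset.sum_mul_sq_le_sq_mul_sq Finset.univ u (fun j : Fin N => xiOdd L ((j : ℕ) + 1) x)
  have hsum : ∑ j : Fin N, xiOdd L ((j : ℕ) + 1) x ^ 2 ≤ N * (2 / L) := by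
    calc ∑ j : Fin N, xiOdd L ((j : ℕ) + 1) x ^ 2 ≤ ∑ _j : Fin N, (2 / L) :=
          Finset.sum_le_sum fun j _ => xiOdd_sq_le hL _ x
      _ = N * (2 / L) := by simp
  have huu : u ⬝ᵥ u = ∑ j, u j ^ 2 := by simp [dotProduct, sq]
  have hprof : profileOdd L u x = ∑ j, u j * xiOdd L ((j : ℕ) + 1) x := rfl
  rw [hprof, huu]
  calc (∑ j : Fin N, u j * xiOdd L ((j : ℕ) + 1) x) ^ 2
        ≤ (∑ j : Fin N, u j ^ 2) * ∑ j : Fin N, xiOdd L ((j : ℕ) + 1) x ^ 2 := hcs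
    _ ≤ (∑ j : Fin N, u j ^ 2) * (N * (2 / L)) :=
        mul_le_mul_of_nonneg_left hsum (Finset.sum_nonneg fun j _ => sq_nonneg _)

/-- PROVED: `(max_H |θ⁻_u|)² ≤ ‖u‖² N · 2/L` (`0 < L`). [folklore] -/
theorem profileOddMax_sq_le {L : ℝ} (hL : 0 < L) {N : ℕ} (u : Fin N → ℝ) :
    profileOddMax L u ^ 2 ≤ (u ⬝ᵥ u) * (N * (2 / L)) := by
  set R := Real.sqrt ((u ⬝ᵥ u) * (N * (2 / L))) with hR
  have hle : profileOddMax L u ≤ R := by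
    unfold profileOddMax
    apply csSup_le ((Set.nonempty_Icc.2 (by linarith)).image _)
    rintro _ ⟨x, _, rfl⟩
    exact Real.abs_le_sqrt (profileOdd_sq_le hL u x)
  calc profileOddMax L u ^ 2 ≤ R ^ 2 := pow_le_pow_left₀ (profileOddMax_nonneg L u) hle 2
    _ = (u ⬝ᵥ u) * (N * (2 / L)) := Real.sq_sqrt (mul_nonneg (dotProduct_self_nonneg_real u) (by positivity))

/-- **PROVED — SINE ORTHONORMALITY on the window:** `∫_{-L/2}^{L/2} ξ₋ₙ ξ₋ₘ = δ_{nm}` for `n, m ≥ 1` (`0 < L`). [folklore] -/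
theorem integral_xiOdd_mul_xiOdd {L : ℝ} (hL : 0 < L) {n m : ℕ} (_hn : n ≠ 0) (hm : m ≠ 0) :
    ∫ x in (-(L / 2))..(L / 2), xiOdd L n x * xiOdd L m x = if n = m then 1 else 0 := by
  have hLne : L ≠ 0 := hL.ne'
  have hss : ∀ p q : ℝ, Real.sin p * Real.sin q = (Real.cos (p - q) - Real.cos (p + q)) / 2 :=
    fun p q => by rw [Real.cos_sub, Real.cos_add]; ring
  have hprod : (fun x => xiOdd L n x * xiOdd L m x) = fun x =>
      ((-1 : ℝ) ^ n * (-1 : ℝ) ^ m * (2 / L) / 2) *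
        (Real.cos (2 * π * n * x / L - 2 * π * m * x / L)
          - Real.cos (2 * π * n * x / L + 2 * π * m * x / L)) := by
    funext x
    simp only [xiOdd]
    have h2 : Real.sqrt (2 / L) * Real.sqrt (2 / L) = 2 / L := Real.mul_self_sqrt (by positivity)
    rw [show (-1 : ℝ) ^ n * Real.sqrt (2 / L) * Real.sin (2 * π * n * x / L)
        * ((-1 : ℝ) ^ m * Real.sqrt (2 / L) * Real.sin (2 * π * m * x / L))
        = (-1 : ℝ) ^ n * (-1 : ℝ) ^ m * (Real.sqrt (2 / L) * Real.sqrt (2 / L))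
          * (Real.sin (2 * π * n * x / L) * Real.sin (2 * π * m * x / L)) by ring, h2, hss]
    ring
  rw [hprod, intervalIntegral.integral_const_mul,
    intervalIntegral.integral_sub (Continuous.intervalIntegrable (by fun_prop) _ _)
      (Continuous.intervalIntegrable (by fun_prop) _ _)]
  have hsum : ∫ x in (-(L / 2))..(L / 2), Real.cos (2 * π * n * x / L + 2 * π * m * x / L) = 0 := by
    have hf : (fun x => Real.cos (2 * π * n * x / L + 2 * π * m * x / L))
        = fun x => Real.cos (2 * π * ((n + m : ℕ) : ℝ) * x / L) := by
      funext x; congr 1; push_cast; ring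
    rw [hf]
    exact CentralMassFloor.integral_cos_mode_window hL (by omega)
  rw [hsum, sub_zero]
  by_cases hnm : n = m
  · subst hnm
    simp only [if_true, sub_self, Real.cos_zero, intervalIntegral.integral_const, smul_eq_mul, mul_one]
    rw [← mul_pow, show (-1 : ℝ) * -1 = 1 by norm_num, one_pow]
    field_simp
    ring
  · simp only [hnm, if_false]
    have hdiff : ∫ x in (-(L / 2))..(L / 2), Real.cos (2 * π * n * x / L - 2 * π * m * x / L) = 0 := by
      have hc : (2 * π * ((n : ℝ) - m) / L) ≠ 0 := by
        have hnm' : ((n : ℝ) - m) ≠ 0 := by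
          rw [sub_ne_zero]; exact_mod_cast hnm
        have hπ : (2 * π : ℝ) ≠ 0 := by positivity
        exact div_ne_zero (mul_ne_zero hπ hnm') hLne
      have hf : (fun x => Real.cos (2 * π * n * x / L - 2 * π * m * x / L))
          = fun x => Real.cos (2 * π * ((n : ℝ) - m) / L * x) := by
        funext x; congr 1; ring
      rw [hf]
      refine CentralMassFloor.integral_cos_mul_window hc ((n : ℤ) - m) ?_
      push_cast
      field_simp
    rw [hdiff, mul_zero]

/-- **PROVED — SINE PARSEVAL on the window:** `∫_{-L/2}^{L/2} (θ⁻_u)² = ‖u‖²` (`0 < L`). [folklore] -/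
theorem integral_profileOdd_sq {L : ℝ} (hL : 0 < L) {N : ℕ} (u : Fin N → ℝ) :
    ∫ x in (-(L / 2))..(L / 2), profileOdd L u x ^ 2 = u ⬝ᵥ u := by
  have hint : ∀ x, profileOdd L u x ^ 2
      = ∑ j : Fin N, ∑ m : Fin N, u j * u m * (xiOdd L ((j : ℕ) + 1) x * xiOdd L ((m : ℕ) + 1) x) := by
    intro x; unfold profileOdd; rw [sq, Finset.sum_mul_sum]
    exact Finset.sum_congr rfl fun j _ => Finset.sum_congr rfl fun m _ => by ring
  simp_rw [hint]
  rw [intervalIntegral.integral_finsetSum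
    (f := fun (j : Fin N) x => ∑ m : Fin N, u j * u m * (xiOdd L ((j : ℕ) + 1) x * xiOdd L ((m : ℕ) + 1) x))
    (fun j _ => Continuous.intervalIntegrable (by fun_prop) _ _)]
  have hrow : ∀ j : Fin N,
      ∫ x in (-(L / 2))..(L / 2), ∑ m : Fin N, u j * u m * (xiOdd L ((j : ℕ) + 1) x * xiOdd L ((m : ℕ) + 1) x)
        = u j * u j := by
    intro j
    rw [intervalIntegral.integral_finsetSum
      (f := fun (m : Fin N) x => u j * u m * (xiOdd L ((j : ℕ) + 1) x * xiOdd L ((m : ℕ) + 1) x))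
      (fun m _ => Continuous.intervalIntegrable (by fun_prop) _ _)]
    simp_rw [intervalIntegral.integral_const_mul, integral_xiOdd_mul_xiOdd hL (Nat.succ_ne_zero _) (Nat.succ_ne_zero _)]
    simp only [Nat.succ_inj, Fin.val_inj, mul_ite, mul_one, mul_zero, Finset.sum_ite_eq, Finset.mem_univ, if_true]
  simp_rw [hrow]
  simp only [dotProduct]

/-- PROVED (pointwise domination on `H`): `|θ⁻_u(x)| ≤ 2 |θ⁻_{u^{om}}(x)| + φ · max_H |θ⁻_u|` for `x ∈ H`. [folklore] -/
theorem abs_profileOdd_le_of_floorOneSignedOdd {L φ : ℝ} (hL : 0 < L) (hφ : 0 ≤ φ) {N : ℕ} {u : Fin N → ℝ}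
    (h : FloorOneSignedOdd L φ u) {x : ℝ} (hx : x ∈ Icc 0 (L / 2)) :
    |profileOdd L u x| ≤ 2 * |profileOdd L (oddModePart u) x| + φ * profileOddMax L u := by
  have hx' : L / 2 - x ∈ Icc 0 (L / 2) := ⟨by linarith [hx.2], by linarith [hx.1]⟩
  have hval : profileOdd L u (L / 2 - x) = profileOdd L (flipVecOdd u) x := profileOdd_half_sub hL.ne' u x
  have hsum := profileOdd_add_profileOdd_flipVecOdd (L := L) u x
  have hφM : 0 ≤ φ * profileOddMax L u := mul_nonneg hφ (profileOddMax_nonneg L u)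
  have habs := le_abs_self (profileOdd L (oddModePart u) x)
  have habs' := neg_abs_le (profileOdd L (oddModePart u) x)
  rw [abs_le]
  rcases h with h | h
  · have h1 := h x hx
    have h2 := h _ hx'
    rw [hval] at h2
    constructor <;> linarith
  · have h1 := h x hx
    have h2 := h _ hx'
    rw [hval] at h2
    constructor <;> linarith

/-- PROVED: the same domination on the FULL window (odd profiles are antisymmetric). [folklore] -/
theorem abs_profileOdd_le_of_floorOneSignedOdd' {L φ : ℝ} (hL : 0 < L) (hφ : 0 ≤ φ) {N : ℕ} {u : Fin N → ℝ}
    (h : FloorOneSignedOdd L φ u) {x : ℝ} (hx : x ∈ Icc (-(L / 2)) (L / 2)) :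
    |profileOdd L u x| ≤ 2 * |profileOdd L (oddModePart u) x| + φ * profileOddMax L u := by
  by_cases h0 : 0 ≤ x
  · exact abs_profileOdd_le_of_floorOneSignedOdd hL hφ h ⟨h0, hx.2⟩
  · have hnx : -x ∈ Icc 0 (L / 2) := ⟨by linarith [not_le.1 h0], by linarith [hx.1]⟩
    have h1 := abs_profileOdd_le_of_floorOneSignedOdd hL hφ h hnx
    rwa [profileOdd_neg, profileOdd_neg, abs_neg, abs_neg] at h1

/-- **PROVED — THE PARITY-MASS LAW (odd sector):** `FloorOneSignedOdd L φ u` (`0 < L`, `0 ≤ φ`) gives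
`‖u‖² ≤ 8 ‖u^{om}‖² + 4 φ² N ‖u‖²`. [folklore] -/
theorem parityMassOdd_le_of_floorOneSignedOdd {L φ : ℝ} (hL : 0 < L) (hφ : 0 ≤ φ) {N : ℕ} {u : Fin N → ℝ}
    (h : FloorOneSignedOdd L φ u) :
    u ⬝ᵥ u ≤ 8 * (oddModePart u ⬝ᵥ oddModePart u) + 4 * φ ^ 2 * N * (u ⬝ᵥ u) := by
  set M := profileOddMax L u with hMdef
  have hpt : ∀ x ∈ Icc (-(L / 2)) (L / 2),
      profileOdd L u x ^ 2 ≤ 8 * profileOdd L (oddModePart u) x ^ 2 + 2 * (φ * M) ^ 2 := by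
    intro x hx
    have h1 := abs_profileOdd_le_of_floorOneSignedOdd' hL hφ h hx
    have hsq : |profileOdd L u x| ^ 2 ≤ (2 * |profileOdd L (oddModePart u) x| + φ * M) ^ 2 :=
      pow_le_pow_left₀ (abs_nonneg _) h1 2
    rw [sq_abs] at hsq
    nlinarith [sq_abs (profileOdd L (oddModePart u) x), sq_nonneg (2 * |profileOdd L (oddModePart u) x| - φ * M)]
  have hc1 : Continuous fun x => profileOdd L u x ^ 2 := (continuous_profileOdd L u).pow 2
  have hc2 : Continuous fun x => 8 * profileOdd L (oddModePart u) x ^ 2 :=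
    continuous_const.mul ((continuous_profileOdd L _).pow 2)
  have hc3 : Continuous fun _ : ℝ => 2 * (φ * M) ^ 2 := continuous_const
  have hint : ∫ x in (-(L / 2))..(L / 2), profileOdd L u x ^ 2
      ≤ ∫ x in (-(L / 2))..(L / 2), (8 * profileOdd L (oddModePart u) x ^ 2 + 2 * (φ * M) ^ 2) :=
    intervalIntegral.integral_mono_on (by linarith) (hc1.intervalIntegrable _ _)
      ((hc2.add hc3).intervalIntegrable _ _) hpt
  have hrhs : ∫ x in (-(L / 2))..(L / 2), (8 * profileOdd L (oddModePart u) x ^ 2 + 2 * (φ * M) ^ 2)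
      = 8 * (oddModePart u ⬝ᵥ oddModePart u) + 2 * (φ * M) ^ 2 * L := by
    rw [intervalIntegral.integral_add (hc2.intervalIntegrable _ _) (hc3.intervalIntegrable _ _),
      intervalIntegral.integral_const_mul, integral_profileOdd_sq hL, intervalIntegral.integral_const, smul_eq_mul]
    ring
  have hM2 : M ^ 2 ≤ (u ⬝ᵥ u) * (N * (2 / L)) := profileOddMax_sq_le hL u
  have hML : (φ * M) ^ 2 * L ≤ 2 * φ ^ 2 * N * (u ⬝ᵥ u) := by
    have h1 : φ ^ 2 * M ^ 2 ≤ φ ^ 2 * ((u ⬝ᵥ u) * (N * (2 / L))) := mul_le_mul_of_nonneg_left hM2 (sq_nonneg φ)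
    calc (φ * M) ^ 2 * L = φ ^ 2 * M ^ 2 * L := by ring
      _ ≤ φ ^ 2 * ((u ⬝ᵥ u) * (N * (2 / L))) * L := mul_le_mul_of_nonneg_right h1 hL.le
      _ = 2 * φ ^ 2 * N * (u ⬝ᵥ u) := by
          field_simp
  rw [integral_profileOdd_sq hL u, hrhs] at hint
  linarith

/-- PROVED (raw odd reader): `OneSignedOdd L u ⇒ ‖u‖² ≤ 8 ‖u^{om}‖²`. [folklore] -/
theorem parityMassOdd_le_of_oneSignedOdd {L : ℝ} (hL : 0 < L) {N : ℕ} {u : Fin N → ℝ} (h : OneSignedOdd L u) :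
    u ⬝ᵥ u ≤ 8 * (oddModePart u ⬝ᵥ oddModePart u) := by
  have h0 := parityMassOdd_le_of_floorOneSignedOdd hL le_rfl ((floorOneSignedOdd_zero_iff L u).2 h)
  simpa using h0

/-- PROVED (floored odd reader, small floor): `8 φ² N ≤ 1 ⇒ ‖u‖² ≤ 16 ‖u^{om}‖²`. [folklore] -/
theorem parityMassOdd_le_of_floorOneSignedOdd' {L φ : ℝ} (hL : 0 < L) (hφ : 0 ≤ φ) {N : ℕ} {u : Fin N → ℝ}
    (hφN : 8 * φ ^ 2 * N ≤ 1) (h : FloorOneSignedOdd L φ u) :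
    u ⬝ᵥ u ≤ 16 * (oddModePart u ⬝ᵥ oddModePart u) := by
  have h0 := parityMassOdd_le_of_floorOneSignedOdd hL hφ h
  have h1 : 8 * φ ^ 2 * N * (u ⬝ᵥ u) ≤ 1 * (u ⬝ᵥ u) := mul_le_mul_of_nonneg_right hφN (dotProduct_self_nonneg_real u)
  linarith

/-- PROVED: a nonzero odd-sector vector supported on EVEN-n sine modes is never one-signed on `H` (its profile is
antisymmetric about `L/4`). [folklore] -/
theorem not_oneSignedOdd_of_oddModePart_eq_zero {L : ℝ} (hL : 0 < L) {N : ℕ} {u : Fin N → ℝ} (hu : u ≠ 0)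
    (he : oddModePart u = 0) : ¬ OneSignedOdd L u := by
  intro h
  have h1 := parityMassOdd_le_of_oneSignedOdd hL h
  rw [he] at h1
  simp only [dotProduct_zero, mul_zero] at h1
  exact hu (dotProduct_self_eq_zero.1 (le_antisymm h1 (dotProduct_self_nonneg_real u)))

end Summit.RiemannHypothesis.RiemannHypothesis.Theorems.PfPersistence
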